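import Summits.QuantumFields.YangMills.Theorems.BalabanUVNodesK2NamedJetsRunRemAt

/-!
# Crux K2⁷ `EndpointGivenBR13SepCoPH` (stmt-QuantumFields-20543), LINE 1′ «named jets» — THE K-KEYED STUB TEXTS (plan g82's v5 prefix
# «unity ∧ slots → Admissible → (B) → window», = the crux's OWN hypothesis prefix) ON BOTH LETTERS `RemAt` ∕ `RunRemAt` AND ON THE ANCHOR,
# composed to the crux decl BY NAME; plus the one-line bridges v4-texts ⟹ K-texts and box ⟹ run

Cell `ym-nodeO-ideate`, DEFINER seat `ym-nodeO-def-1` (gen 4; director-ym R361 ∕ №21).  TRIGGER: plan g82's DECISION on director-ym LINE №204 T1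
(desk `pub-ymgap-plan/D82-K2V5/DECISION-204.md`): «NO numeric ε₂₉ row is written into any text; every K2⁷ stub is re-keyed, in skeleton v5, from
`∀ F θ hP, θ.Admissible F 2 → …` to the crux's OWN hypothesis prefix `∀ F θ hP, (θ.ZhUnity F 2 ∧ θ.SlotsNondegenerate₁₃ F 2) → θ.Admissible F 2 →
B16.EndStatementBPrinted D.C → Window13 F θ hP → …`» together with its remark «an ed.4 concluder in the tree is welcome, not load-bearing», and CRIT-1 g4's
pre-registration note (bus NODEO-CRIT1-G4-V5NOTE: swap `RemAt ↦ RunRemAt` after barrier note BN-F; key stub 1′ on the ANCHOR) — BOTH CARRIED by plan g82's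
skeleton v6 5a75a2378c79b303 (REGISTERED 2026-08-28T02:32:34Z, superseding v5 16e2ea6200bb4554 of 02:22:53Z): TWO registered stubs `stub_d1AnchoredJets13 : D1AtAnchoredJets`
(anchor-keyed (D1), full prefix) and `stub_runRemNamedJets13 : RunRemAtSomeJets` (run letter, full prefix), in-file pointwise composition `EndpointGivenBR13SepCoPH_of_anchoredJetsRun`.
Helper for crux K2⁷ = stmt-QuantumFields-20543 (`--supports 20543`); count-neutral.  Fourth file of the letter lineage after `Thm/BalabanUVNodesK2JsOfRecord`
(p588621), `Thm/BalabanUVNodesK2NamedJetsRemAt` (p593586: box letter `RemAt`, v4 concluder `EndpointGivenBR13SepCoPH_of_shadowingJets`) and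
`Thm/BalabanUVNodesK2NamedJetsRunRemAt` (p596574: run letter `RunRemAt`, concluders `EndpointGivenBR13SepCoPH_of_runShadowingJetsGivenB` ∕ `…_anchorRoad`).

WHY.  The tree concluders of p593586 ∕ p596574 are typed on the v4 texts (keyed on `θ.Admissible F 2` alone, resp. on unity ∧ Admissible ∧ (B) without the
window).  A v5 stub carries MORE antecedents (the full prefix, window included), so as a hypothesis it gives LESS: no tree concluder applies to a v5 stub
verbatim.  This file types the K-keyed text sets of the v5∕v6 cuts — anchor-keyed (D1)ᴷ + run 2ᴮ″ᴷ (= THE REGISTERED v6 texts `D1AtAnchoredJets` ∕ `RunRemAtSomeJets`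
VERBATIM with v6's local `Window13 F θ hP` unfolded), the run pair {1ᴮ″ᴷ, 2ᴮ″ᴷ}, the box pair {1′ᴷ, 2′ᴷ} (= v5's superseded texts `D1AtShadowingJets` ∕ `RemAtSomeJets`) and
(D1)ᴷ + box 2′ᴷ — each composed to the crux decl BY NAME through the TREE's
POINTWISE END lemmas `BalabanUVNodesK2NamedJetsRemAt.endpointExistence_of_remAt_drift` ∕ `BalabanUVNodesK2NamedJetsRunRemAt.endpointExistence_of_runRemAt_drift`,
so that the final sorry-free K2⁷ assembly can conclude by ONE tree name — kernel-checked against the registered v6 bytes: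
`exact EndpointGivenBR13SepCoPH_of_anchorKeyedK_runShadowingJetsK stub_d1AnchoredJets13 stub_runRemNamedJets13` elaborates (`Window13` unfolds by `rfl` to the window
spelled INLINE here exactly as the crux decl spells it), and likewise `…_of_shadowingJetsK` against v5's pair; no `def` is introduced (texts are hypotheses spelled inline, never parameterless
`def … : Prop` under `Theorems/`).  The bridges record the directions once: a v4-text theorem GIVES the K-text (antecedents discarded), box GIVES run
(`runRemAt_of_remAt`), the anchor-keyed (D1) road GIVES both 1-texts (the anchor is a conjunct of both letters).

WHAT IS HERE (0 `def` + 9 theorems; 0 `sorry`; pure bookkeeping BY NAME): §1 bridges `remAtSomeJetsK_of_remAtSomeJets`, `d1AtShadowingJetsK_of_d1AtShadowingJets`,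
`runRemAtSomeJetsK_of_runRemAtSomeJetsGivenB`, `runRemAtSomeJetsK_of_remAtSomeJetsK`, `d1AtRunShadowingJetsK_of_anchorKeyedK`, `d1AtShadowingJetsK_of_anchorKeyedK`;
§2 concluders ★★ `EndpointGivenBR13SepCoPH_of_anchorKeyedK_runShadowingJetsK` (anchor-keyed (D1)ᴷ + 2ᴮ″ᴷ = v6's REGISTERED pair), ★ `EndpointGivenBR13SepCoPH_of_runShadowingJetsK`
(run pair), ★ `EndpointGivenBR13SepCoPH_of_shadowingJetsK` (box pair = v5's pair), ★ `EndpointGivenBR13SepCoPH_of_anchorKeyedK_shadowingJetsK` ((D1)ᴷ + 2′ᴷ).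

HONEST FRAMING.  Implications between displayed hypothesis SHAPES and four compositions; NOTHING of Bałaban's analysis is asserted or discharged: every
remainder ∕ anchor ∕ continuity ∕ drift text is a HYPOTHESIS inhabited at no θ here (instance 0∕1); (P6) and `c⋆` NOT decided; K2⁷ ∕ its six stubs NOT proved
(skeleton of record v6 5a75a2378c79b303: two registered stubs, 0 closed); counts unmoved; [Balaban1987RG1] Thm 2 + (0.31) p. 259 (NODE O)
is UNPROVED IN PRINT; route R4 closes the conditional finite-𝕋⁴ rung only — NOT the continuum limit, NOT ℝ⁴, NOT OS, NOT a mass gap, NOT Clay.  No `instance`,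
no `notation`, no `axiom`.  Sources (context only; nothing printed is used as a hypothesis): [I] = [Balaban1987RG1] CMP **109** (1987): Thm 2 p. 259 (first
sentence), (1.3) p. 260, (1.20)–(1.22) p. 264, Thm 3 p. 264 (the printed quantifier shape: ε₁ is CHOSEN by the theorem), (2.12)–(2.14) p. 268, (5.10) p. 293.
-/

noncomputable section

namespace Summit.QuantumFields.YangMills.Theorems.BalabanUVNodesK2NamedJetsKKeyed

open Literature.MathematicalPhysics.QuantumFieldTheory.Balaban1983to89
open Literature.MathematicalPhysics.QuantumFieldTheory.Balaban1983to89.DagBinding (EndpointExistence)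
open Literature.MathematicalPhysics.QuantumFieldTheory.Balaban1983to89.T4Continuum (T4Family)
open Literature.MathematicalPhysics.QuantumFieldTheory.Balaban1983to89.Beta.Drift (OneLoopDrift)
open Summit.QuantumFields.YangMills.Theorems.BalabanUVNodesK2JsOfRecord (StepColourData beta0OfJs)
open Summit.QuantumFields.YangMills.Theorems.BalabanUVNodesK2NamedJetsRemAt (RemAt ScaleAnchor endpointExistence_of_remAt_drift)
open Summit.QuantumFields.YangMills.Theorems.BalabanUVNodesK2NamedJetsRunRemAt (RunRemAt runRemAt_of_remAt endpointExistence_of_runRemAt_drift)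

/-! ## §1 The K-keyed texts (spelled INLINE as hypotheses) and the one-line bridges

The common prefix at `(F, θ, hP)` — VERBATIM the crux decl's: `(θ.ZhUnity F 2 ∧ θ.SlotsNondegenerate₁₃ F 2) → θ.Admissible F 2 →
B16.EndStatementBPrinted (Node00.datumOfRecord₁₃SepCoPH F 2 θ hP).C → (∃ γ₁, 0 < γ₁ ∧ ∀ γ, 0 < γ → γ ≤ γ₁ → ∃ P : B12.RunParams, 1 ≤ P.K ∧
((Node00.datumOfRecord₁₃SepCoPH F 2 θ hP).C P).flow.InInterval γ P.K) → …`.  Texts: 2′ᴷ `… → ∃ κ, RemAt F κ θ hP θ.cβ`; 1′ᴷ `∀ F κ θ hP, … → RemAt F κ θ hP θ.cβ →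
∃ A, OneLoopDrift (stepBal 2 F.L) A (beta0OfJs F κ)`; 2ᴮ″ᴷ ∕ 1ᴮ″ᴷ the same over `RunRemAt`; (D1)ᴷ `∀ F κ θ hP, … → ScaleAnchor (datum).βfun (θ.cβ • beta0OfJs F κ) → ∃ A, …`. -/

section Bridges

/-- v4's STUB 2′ TEXT (keyed on `Admissible` alone) ⟹ THE K-KEYED 2′ᴷ TEXT (the extra antecedents are discarded). [folklore] -/
theorem remAtSomeJetsK_of_remAtSomeJets
    (h : ∀ (F : T4Family) (θ : Node00.Stage13HParams F 2) (hP : θ.Provisos₁₃SepCoPH F 2), θ.Admissible F 2 →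
      ∃ κ : StepColourData, RemAt F κ θ hP θ.cβ) :
    ∀ (F : T4Family) (θ : Node00.Stage13HParams F 2) (hP : θ.Provisos₁₃SepCoPH F 2),
      (θ.ZhUnity F 2 ∧ θ.SlotsNondegenerate₁₃ F 2) → θ.Admissible F 2 →
      B16.EndStatementBPrinted (Node00.datumOfRecord₁₃SepCoPH F 2 θ hP).C →
      (∃ γ₁ : ℝ, 0 < γ₁ ∧ ∀ γ : ℝ, 0 < γ → γ ≤ γ₁ →
        ∃ P : B12.RunParams, 1 ≤ P.K ∧ ((Node00.datumOfRecord₁₃SepCoPH F 2 θ hP).C P).flow.InInterval γ P.K) →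
      ∃ κ : StepColourData, RemAt F κ θ hP θ.cβ :=
  fun F θ hP _ hθ _ _ => h F θ hP hθ

/-- v4's STUB 1′ TEXT ⟹ THE K-KEYED 1′ᴷ TEXT (antecedents discarded). [folklore] -/
theorem d1AtShadowingJetsK_of_d1AtShadowingJets
    (h : ∀ (F : T4Family) (κ : StepColourData) (θ : Node00.Stage13HParams F 2) (hP : θ.Provisos₁₃SepCoPH F 2), θ.Admissible F 2 →
      RemAt F κ θ hP θ.cβ → ∃ A : ℝ, OneLoopDrift (B12Normalization.stepBal 2 F.L) A (beta0OfJs F κ)) :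
    ∀ (F : T4Family) (κ : StepColourData) (θ : Node00.Stage13HParams F 2) (hP : θ.Provisos₁₃SepCoPH F 2),
      (θ.ZhUnity F 2 ∧ θ.SlotsNondegenerate₁₃ F 2) → θ.Admissible F 2 →
      B16.EndStatementBPrinted (Node00.datumOfRecord₁₃SepCoPH F 2 θ hP).C →
      (∃ γ₁ : ℝ, 0 < γ₁ ∧ ∀ γ : ℝ, 0 < γ → γ ≤ γ₁ →
        ∃ P : B12.RunParams, 1 ≤ P.K ∧ ((Node00.datumOfRecord₁₃SepCoPH F 2 θ hP).C P).flow.InInterval γ P.K) →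
      RemAt F κ θ hP θ.cβ → ∃ A : ℝ, OneLoopDrift (B12Normalization.stepBal 2 F.L) A (beta0OfJs F κ) :=
  fun F κ θ hP _ hθ _ _ hRem => h F κ θ hP hθ hRem

/-- p596574's 2ᴮ″ TEXT (unity ∧ Admissible ∧ (B), no window) ⟹ THE K-KEYED 2ᴮ″ᴷ TEXT (the window antecedent is discarded). [folklore] -/
theorem runRemAtSomeJetsK_of_runRemAtSomeJetsGivenB
    (h : ∀ (F : T4Family) (θ : Node00.Stage13HParams F 2) (hP : θ.Provisos₁₃SepCoPH F 2),
      (θ.ZhUnity F 2 ∧ θ.SlotsNondegenerate₁₃ F 2) → θ.Admissible F 2 →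
      B16.EndStatementBPrinted (Node00.datumOfRecord₁₃SepCoPH F 2 θ hP).C →
      ∃ κ : StepColourData, RunRemAt F κ θ hP θ.cβ) :
    ∀ (F : T4Family) (θ : Node00.Stage13HParams F 2) (hP : θ.Provisos₁₃SepCoPH F 2),
      (θ.ZhUnity F 2 ∧ θ.SlotsNondegenerate₁₃ F 2) → θ.Admissible F 2 →
      B16.EndStatementBPrinted (Node00.datumOfRecord₁₃SepCoPH F 2 θ hP).C →
      (∃ γ₁ : ℝ, 0 < γ₁ ∧ ∀ γ : ℝ, 0 < γ → γ ≤ γ₁ →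
        ∃ P : B12.RunParams, 1 ≤ P.K ∧ ((Node00.datumOfRecord₁₃SepCoPH F 2 θ hP).C P).flow.InInterval γ P.K) →
      ∃ κ : StepColourData, RunRemAt F κ θ hP θ.cβ :=
  fun F θ hP hU hθ hB _ => h F θ hP hU hθ hB

/-- BOX ⟹ RUN at the K-keying: the 2′ᴷ text gives the 2ᴮ″ᴷ text (`runRemAt_of_remAt` per record; 2ᴮ″ᴷ is the WEAKER obligation BY NAME). [folklore] -/
theorem runRemAtSomeJetsK_of_remAtSomeJetsK
    (h : ∀ (F : T4Family) (θ : Node00.Stage13HParams F 2) (hP : θ.Provisos₁₃SepCoPH F 2),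
      (θ.ZhUnity F 2 ∧ θ.SlotsNondegenerate₁₃ F 2) → θ.Admissible F 2 →
      B16.EndStatementBPrinted (Node00.datumOfRecord₁₃SepCoPH F 2 θ hP).C →
      (∃ γ₁ : ℝ, 0 < γ₁ ∧ ∀ γ : ℝ, 0 < γ → γ ≤ γ₁ →
        ∃ P : B12.RunParams, 1 ≤ P.K ∧ ((Node00.datumOfRecord₁₃SepCoPH F 2 θ hP).C P).flow.InInterval γ P.K) →
      ∃ κ : StepColourData, RemAt F κ θ hP θ.cβ) :
    ∀ (F : T4Family) (θ : Node00.Stage13HParams F 2) (hP : θ.Provisos₁₃SepCoPH F 2),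
      (θ.ZhUnity F 2 ∧ θ.SlotsNondegenerate₁₃ F 2) → θ.Admissible F 2 →
      B16.EndStatementBPrinted (Node00.datumOfRecord₁₃SepCoPH F 2 θ hP).C →
      (∃ γ₁ : ℝ, 0 < γ₁ ∧ ∀ γ : ℝ, 0 < γ → γ ≤ γ₁ →
        ∃ P : B12.RunParams, 1 ≤ P.K ∧ ((Node00.datumOfRecord₁₃SepCoPH F 2 θ hP).C P).flow.InInterval γ P.K) →
      ∃ κ : StepColourData, RunRemAt F κ θ hP θ.cβ := fun F θ hP hU hθ hB hwin => by
  obtain ⟨κ, hRem⟩ := h F θ hP hU hθ hB hwin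
  exact ⟨κ, runRemAt_of_remAt F κ θ hP hRem⟩

/-- THE ANCHOR-KEYED (D1)ᴷ TEXT ⟹ THE 1ᴮ″ᴷ TEXT: the run letter carries the box-wise anchor as a conjunct, so a (D1) theorem keyed on the anchor (with the full
prefix) discharges stub 1ᴮ″ᴷ. [cite: Balaban1987RG1, (1.3) p.260 and (2.12)–(2.14) p.268] -/
theorem d1AtRunShadowingJetsK_of_anchorKeyedK
    (h : ∀ (F : T4Family) (κ : StepColourData) (θ : Node00.Stage13HParams F 2) (hP : θ.Provisos₁₃SepCoPH F 2),
      (θ.ZhUnity F 2 ∧ θ.SlotsNondegenerate₁₃ F 2) → θ.Admissible F 2 →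
      B16.EndStatementBPrinted (Node00.datumOfRecord₁₃SepCoPH F 2 θ hP).C →
      (∃ γ₁ : ℝ, 0 < γ₁ ∧ ∀ γ : ℝ, 0 < γ → γ ≤ γ₁ →
        ∃ P : B12.RunParams, 1 ≤ P.K ∧ ((Node00.datumOfRecord₁₃SepCoPH F 2 θ hP).C P).flow.InInterval γ P.K) →
      ScaleAnchor (Node00.datumOfRecord₁₃SepCoPH F 2 θ hP).βfun (fun k => θ.cβ * beta0OfJs F κ k) →
      ∃ A : ℝ, OneLoopDrift (B12Normalization.stepBal 2 F.L) A (beta0OfJs F κ)) :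
    ∀ (F : T4Family) (κ : StepColourData) (θ : Node00.Stage13HParams F 2) (hP : θ.Provisos₁₃SepCoPH F 2),
      (θ.ZhUnity F 2 ∧ θ.SlotsNondegenerate₁₃ F 2) → θ.Admissible F 2 →
      B16.EndStatementBPrinted (Node00.datumOfRecord₁₃SepCoPH F 2 θ hP).C →
      (∃ γ₁ : ℝ, 0 < γ₁ ∧ ∀ γ : ℝ, 0 < γ → γ ≤ γ₁ →
        ∃ P : B12.RunParams, 1 ≤ P.K ∧ ((Node00.datumOfRecord₁₃SepCoPH F 2 θ hP).C P).flow.InInterval γ P.K) →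
      RunRemAt F κ θ hP θ.cβ → ∃ A : ℝ, OneLoopDrift (B12Normalization.stepBal 2 F.L) A (beta0OfJs F κ) :=
  fun F κ θ hP hU hθ hB hwin hRun => by
  obtain ⟨-, -, -, -, -, -, hanch, -⟩ := hRun
  exact h F κ θ hP hU hθ hB hwin hanch

/-- THE ANCHOR-KEYED (D1)ᴷ TEXT ⟹ THE 1′ᴷ TEXT (box letter; same extraction of the anchor conjunct). [cite: Balaban1987RG1, (1.3) p.260 and (2.12)–(2.14) p.268] -/
theorem d1AtShadowingJetsK_of_anchorKeyedK
    (h : ∀ (F : T4Family) (κ : StepColourData) (θ : Node00.Stage13HParams F 2) (hP : θ.Provisos₁₃SepCoPH F 2),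
      (θ.ZhUnity F 2 ∧ θ.SlotsNondegenerate₁₃ F 2) → θ.Admissible F 2 →
      B16.EndStatementBPrinted (Node00.datumOfRecord₁₃SepCoPH F 2 θ hP).C →
      (∃ γ₁ : ℝ, 0 < γ₁ ∧ ∀ γ : ℝ, 0 < γ → γ ≤ γ₁ →
        ∃ P : B12.RunParams, 1 ≤ P.K ∧ ((Node00.datumOfRecord₁₃SepCoPH F 2 θ hP).C P).flow.InInterval γ P.K) →
      ScaleAnchor (Node00.datumOfRecord₁₃SepCoPH F 2 θ hP).βfun (fun k => θ.cβ * beta0OfJs F κ k) →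
      ∃ A : ℝ, OneLoopDrift (B12Normalization.stepBal 2 F.L) A (beta0OfJs F κ)) :
    ∀ (F : T4Family) (κ : StepColourData) (θ : Node00.Stage13HParams F 2) (hP : θ.Provisos₁₃SepCoPH F 2),
      (θ.ZhUnity F 2 ∧ θ.SlotsNondegenerate₁₃ F 2) → θ.Admissible F 2 →
      B16.EndStatementBPrinted (Node00.datumOfRecord₁₃SepCoPH F 2 θ hP).C →
      (∃ γ₁ : ℝ, 0 < γ₁ ∧ ∀ γ : ℝ, 0 < γ → γ ≤ γ₁ →
        ∃ P : B12.RunParams, 1 ≤ P.K ∧ ((Node00.datumOfRecord₁₃SepCoPH F 2 θ hP).C P).flow.InInterval γ P.K) →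
      RemAt F κ θ hP θ.cβ → ∃ A : ℝ, OneLoopDrift (B12Normalization.stepBal 2 F.L) A (beta0OfJs F κ) :=
  fun F κ θ hP hU hθ hB hwin hRem => by
  obtain ⟨-, -, -, -, -, -, hanch, -⟩ := hRem
  exact h F κ θ hP hU hθ hB hwin hanch

end Bridges

/-! ## §2 The four compositions to THE CRUX DECL BY NAME (`Summit.QuantumFields.YangMills.Theses.BalabanUVNodes.EndpointGivenBR13SepCoPH`, route rev 25) -/

section Concluders

/-- **★ THE BOX PAIR, K-KEYED → THE CRUX DECL BY NAME** (`h₁` = 1′ᴷ, `h₂` = 2′ᴷ = plan g82's v5 texts `D1AtShadowingJets` ∕ `RemAtSomeJets`, skeleton 16e2ea6200bb4554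
of 02:22:53Z — SUPERSEDED by v6 at 02:32:34Z after BN-F — with `Window13` unfolded).  Per record: κ from 2′ᴷ (ALL four crux hypotheses handed over), the bare drift from 1′ᴷ, then the TREE's pointwise `endpointExistence_of_remAt_drift`
(p593586).  CONDITIONAL on the two displayed shapes; K2⁷ NOT closed. [cite: Balaban1987RG1, Thm 2 p.259 (first sentence), (5.10) p.293 and (2.12)–(2.14) p.268] -/
theorem EndpointGivenBR13SepCoPH_of_shadowingJetsK
    (h₁ : ∀ (F : T4Family) (κ : StepColourData) (θ : Node00.Stage13HParams F 2) (hP : θ.Provisos₁₃SepCoPH F 2),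
      (θ.ZhUnity F 2 ∧ θ.SlotsNondegenerate₁₃ F 2) → θ.Admissible F 2 →
      B16.EndStatementBPrinted (Node00.datumOfRecord₁₃SepCoPH F 2 θ hP).C →
      (∃ γ₁ : ℝ, 0 < γ₁ ∧ ∀ γ : ℝ, 0 < γ → γ ≤ γ₁ →
        ∃ P : B12.RunParams, 1 ≤ P.K ∧ ((Node00.datumOfRecord₁₃SepCoPH F 2 θ hP).C P).flow.InInterval γ P.K) →
      RemAt F κ θ hP θ.cβ → ∃ A : ℝ, OneLoopDrift (B12Normalization.stepBal 2 F.L) A (beta0OfJs F κ))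
    (h₂ : ∀ (F : T4Family) (θ : Node00.Stage13HParams F 2) (hP : θ.Provisos₁₃SepCoPH F 2),
      (θ.ZhUnity F 2 ∧ θ.SlotsNondegenerate₁₃ F 2) → θ.Admissible F 2 →
      B16.EndStatementBPrinted (Node00.datumOfRecord₁₃SepCoPH F 2 θ hP).C →
      (∃ γ₁ : ℝ, 0 < γ₁ ∧ ∀ γ : ℝ, 0 < γ → γ ≤ γ₁ →
        ∃ P : B12.RunParams, 1 ≤ P.K ∧ ((Node00.datumOfRecord₁₃SepCoPH F 2 θ hP).C P).flow.InInterval γ P.K) →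
      ∃ κ : StepColourData, RemAt F κ θ hP θ.cβ) :
    Summit.QuantumFields.YangMills.Theses.BalabanUVNodes.EndpointGivenBR13SepCoPH := by
  intro F θ hP hU hθ hB hwin
  obtain ⟨κ, hRem⟩ := h₂ F θ hP hU hθ hB hwin
  obtain ⟨A, hdrift⟩ := h₁ F κ θ hP hU hθ hB hwin hRem
  exact endpointExistence_of_remAt_drift F κ θ hP hRem hdrift

/-- **★ THE RUN PAIR, K-KEYED → THE CRUX DECL BY NAME** (`h₁` = 1ᴮ″ᴷ, `h₂` = 2ᴮ″ᴷ; = CRIT-1 g4's recommended v5 texts after barrier note BN-F: the letter read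
along the in-window runs and on the survivor sets).  Per record: κ from 2ᴮ″ᴷ, the bare drift from 1ᴮ″ᴷ, then the TREE's pointwise
`endpointExistence_of_runRemAt_drift` (p596574).  CONDITIONAL; K2⁷ NOT closed. [cite: Balaban1987RG1, Thm 2 p.259 (first sentence), Thm 3 p.264 and (5.10) p.293] -/
theorem EndpointGivenBR13SepCoPH_of_runShadowingJetsK
    (h₁ : ∀ (F : T4Family) (κ : StepColourData) (θ : Node00.Stage13HParams F 2) (hP : θ.Provisos₁₃SepCoPH F 2),
      (θ.ZhUnity F 2 ∧ θ.SlotsNondegenerate₁₃ F 2) → θ.Admissible F 2 →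
      B16.EndStatementBPrinted (Node00.datumOfRecord₁₃SepCoPH F 2 θ hP).C →
      (∃ γ₁ : ℝ, 0 < γ₁ ∧ ∀ γ : ℝ, 0 < γ → γ ≤ γ₁ →
        ∃ P : B12.RunParams, 1 ≤ P.K ∧ ((Node00.datumOfRecord₁₃SepCoPH F 2 θ hP).C P).flow.InInterval γ P.K) →
      RunRemAt F κ θ hP θ.cβ → ∃ A : ℝ, OneLoopDrift (B12Normalization.stepBal 2 F.L) A (beta0OfJs F κ))
    (h₂ : ∀ (F : T4Family) (θ : Node00.Stage13HParams F 2) (hP : θ.Provisos₁₃SepCoPH F 2),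
      (θ.ZhUnity F 2 ∧ θ.SlotsNondegenerate₁₃ F 2) → θ.Admissible F 2 →
      B16.EndStatementBPrinted (Node00.datumOfRecord₁₃SepCoPH F 2 θ hP).C →
      (∃ γ₁ : ℝ, 0 < γ₁ ∧ ∀ γ : ℝ, 0 < γ → γ ≤ γ₁ →
        ∃ P : B12.RunParams, 1 ≤ P.K ∧ ((Node00.datumOfRecord₁₃SepCoPH F 2 θ hP).C P).flow.InInterval γ P.K) →
      ∃ κ : StepColourData, RunRemAt F κ θ hP θ.cβ) :
    Summit.QuantumFields.YangMills.Theses.BalabanUVNodes.EndpointGivenBR13SepCoPH := by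
  intro F θ hP hU hθ hB hwin
  obtain ⟨κ, hRun⟩ := h₂ F θ hP hU hθ hB hwin
  obtain ⟨A, hdrift⟩ := h₁ F κ θ hP hU hθ hB hwin hRun
  exact endpointExistence_of_runRemAt_drift F κ θ hP hRun hdrift

/-- **★★ THE ANCHOR-KEYED (D1)ᴷ TEXT + THE RUN TEXT 2ᴮ″ᴷ → THE CRUX DECL BY NAME — THE REGISTERED PAIR OF SKELETON v6 5a75a2378c79b303** (`hD1` = v6's
`D1AtAnchoredJets`, `h₂` = v6's `RunRemAtSomeJets`, VERBATIM with `Window13` unfolded; director-ym №24 (a)+(d), CRIT-1 g4 BN-F addendum): `d1AtRunShadowingJetsK_of_anchorKeyedK`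
then the run pair; `exact EndpointGivenBR13SepCoPH_of_anchorKeyedK_runShadowingJetsK stub_d1AnchoredJets13 stub_runRemNamedJets13` closes the crux modulo the two registered
stubs (= v6's in-file `EndpointGivenBR13SepCoPH_of_anchoredJetsRun`, now a tree name).  CONDITIONAL; K2⁷ NOT closed. [cite: Balaban1987RG1, Thm 2 p.259 (first sentence) and (1.3) p.260] -/
theorem EndpointGivenBR13SepCoPH_of_anchorKeyedK_runShadowingJetsK
    (hD1 : ∀ (F : T4Family) (κ : StepColourData) (θ : Node00.Stage13HParams F 2) (hP : θ.Provisos₁₃SepCoPH F 2),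
      (θ.ZhUnity F 2 ∧ θ.SlotsNondegenerate₁₃ F 2) → θ.Admissible F 2 →
      B16.EndStatementBPrinted (Node00.datumOfRecord₁₃SepCoPH F 2 θ hP).C →
      (∃ γ₁ : ℝ, 0 < γ₁ ∧ ∀ γ : ℝ, 0 < γ → γ ≤ γ₁ →
        ∃ P : B12.RunParams, 1 ≤ P.K ∧ ((Node00.datumOfRecord₁₃SepCoPH F 2 θ hP).C P).flow.InInterval γ P.K) →
      ScaleAnchor (Node00.datumOfRecord₁₃SepCoPH F 2 θ hP).βfun (fun k => θ.cβ * beta0OfJs F κ k) →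
      ∃ A : ℝ, OneLoopDrift (B12Normalization.stepBal 2 F.L) A (beta0OfJs F κ))
    (h₂ : ∀ (F : T4Family) (θ : Node00.Stage13HParams F 2) (hP : θ.Provisos₁₃SepCoPH F 2),
      (θ.ZhUnity F 2 ∧ θ.SlotsNondegenerate₁₃ F 2) → θ.Admissible F 2 →
      B16.EndStatementBPrinted (Node00.datumOfRecord₁₃SepCoPH F 2 θ hP).C →
      (∃ γ₁ : ℝ, 0 < γ₁ ∧ ∀ γ : ℝ, 0 < γ → γ ≤ γ₁ →
        ∃ P : B12.RunParams, 1 ≤ P.K ∧ ((Node00.datumOfRecord₁₃SepCoPH F 2 θ hP).C P).flow.InInterval γ P.K) →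
      ∃ κ : StepColourData, RunRemAt F κ θ hP θ.cβ) :
    Summit.QuantumFields.YangMills.Theses.BalabanUVNodes.EndpointGivenBR13SepCoPH :=
  EndpointGivenBR13SepCoPH_of_runShadowingJetsK (d1AtRunShadowingJetsK_of_anchorKeyedK hD1) h₂

/-- **★ THE ANCHOR-KEYED (D1)ᴷ TEXT + THE BOX TEXT 2′ᴷ → THE CRUX DECL BY NAME** (v5 draft's 2′ as is, (D1) keyed on the anchor): box ⟹ run
(`runRemAtSomeJetsK_of_remAtSomeJetsK`), then the previous concluder.  CONDITIONAL; K2⁷ NOT closed. [cite: Balaban1987RG1, Thm 2 p.259 (first sentence) and (1.3) p.260] -/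
theorem EndpointGivenBR13SepCoPH_of_anchorKeyedK_shadowingJetsK
    (hD1 : ∀ (F : T4Family) (κ : StepColourData) (θ : Node00.Stage13HParams F 2) (hP : θ.Provisos₁₃SepCoPH F 2),
      (θ.ZhUnity F 2 ∧ θ.SlotsNondegenerate₁₃ F 2) → θ.Admissible F 2 →
      B16.EndStatementBPrinted (Node00.datumOfRecord₁₃SepCoPH F 2 θ hP).C →
      (∃ γ₁ : ℝ, 0 < γ₁ ∧ ∀ γ : ℝ, 0 < γ → γ ≤ γ₁ →
        ∃ P : B12.RunParams, 1 ≤ P.K ∧ ((Node00.datumOfRecord₁₃SepCoPH F 2 θ hP).C P).flow.InInterval γ P.K) →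
      ScaleAnchor (Node00.datumOfRecord₁₃SepCoPH F 2 θ hP).βfun (fun k => θ.cβ * beta0OfJs F κ k) →
      ∃ A : ℝ, OneLoopDrift (B12Normalization.stepBal 2 F.L) A (beta0OfJs F κ))
    (h₂ : ∀ (F : T4Family) (θ : Node00.Stage13HParams F 2) (hP : θ.Provisos₁₃SepCoPH F 2),
      (θ.ZhUnity F 2 ∧ θ.SlotsNondegenerate₁₃ F 2) → θ.Admissible F 2 →
      B16.EndStatementBPrinted (Node00.datumOfRecord₁₃SepCoPH F 2 θ hP).C →
      (∃ γ₁ : ℝ, 0 < γ₁ ∧ ∀ γ : ℝ, 0 < γ → γ ≤ γ₁ →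
        ∃ P : B12.RunParams, 1 ≤ P.K ∧ ((Node00.datumOfRecord₁₃SepCoPH F 2 θ hP).C P).flow.InInterval γ P.K) →
      ∃ κ : StepColourData, RemAt F κ θ hP θ.cβ) :
    Summit.QuantumFields.YangMills.Theses.BalabanUVNodes.EndpointGivenBR13SepCoPH :=
  EndpointGivenBR13SepCoPH_of_anchorKeyedK_runShadowingJetsK hD1 (runRemAtSomeJetsK_of_remAtSomeJetsK h₂)

end Concluders

end Summit.QuantumFields.YangMills.Theorems.BalabanUVNodesK2NamedJetsKKeyed

end
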